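import Summits.ResolutionOfSingularities.ResolutionOfSingularities.Theorems.EquisingularLiftEquisingularLiftNatCechShadowNew
import Summits.ResolutionOfSingularities.ResolutionOfSingularities.Theorems.EquisingularLiftEquisingularLiftNatCechShadowOldIso
import Summits.ResolutionOfSingularities.ResolutionOfSingularities.Theorems.EquisingularLiftEquisingularLiftNatTowerCechRoundOldThree
import Literature.AlgebraicGeometry.Resolution.EffectiveCartierStalks
import Literature.AlgebraicGeometry.Resolution.StrictTransformBaseChange
import Literature.AlgebraicGeometry.Resolution.StalkIdealLemmas
import Literature.AlgebraicGeometry.Resolution.MarkedIdeals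
import HarnessLib

/-!
# [OURS · L1 W4.5(b) · EL♮(3)] LOCAL TOOLS OF THE (N3′) DISCHARGER — point forms of the quotient isomorphism through `τ♯`, the old (k-iv) hypothesis from
# reducedness upstairs, and (k-v)′/(k-vi)′ for the transported old pair `(St_𝒞 𝓔, St_𝒞 𝒦)`

Crux chain w45b (cell `res-hironaka`, slot W4.5(b)), working crux **EL♮** = stmt-ResolutionOfSingularities-20038, child **EL♮(3)** =
stmt-ResolutionOfSingularities-20148, route EquisingularLift, line `sections`; registered stub `stub_elnat_coneTowerPointResolution` @ `ReachTower₄`;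
sub-stand-in (N3′) `hShadowOld` of res-L1-w45b-stub-4's `Tower.hCech₃_of_lift_sec_kiv` (p579344), discharged in …NatCechShadowOld on top of this file.
Written by res-L1-w45b-stub-2 g8. HONEST FRAMING: OURS; NOT a statement of any manuscript; AI-written, weaker than expert review. No `sorry`; standard
axioms; DEF-FREE. `--supports stmt-ResolutionOfSingularities-20148 --as helper`.

WHAT.
* `exists_sub_stalkMap_mem_of_iso_over'`, `stalkMap_mem_sup_map_iff_of_iso_over'`, `exists_ringEquiv_quotient_of_iso_over'` — the statements of
  …NatCechShadowOldIso at a point `y₂ ∈ V(I₂)` of `X₂` (instead of `ι_{I₂} z`);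
* **`stalkIdeal_sup_vanishingIdeal_eq_inter_of_isReduced`** — in a model square over a DVR, reducedness of `𝒪_{X,j p}/((𝓔 + 𝒦)_{j p} + (ϖ))` gives the
  old (k-iv) hypothesis `(𝓘⟨E⟩ + 𝓘⟨K⟩)_p = 𝓘⟨E ∩ K⟩_p` (`𝓘⟨E ∩ K⟩ = √(𝓘⟨E⟩ + 𝓘⟨K⟩)`, Mathlib `vanishingIdeal_support`);
* **`isEffectiveCartier_strictTransform_old_pair`** — for a Čech round `τ = Bl_{𝓔 ⊔ 𝒦₁}` (regular centre, `𝒦₁|V(𝓔)` Cartier) of a regular `X` and an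
  old pair `(𝓔, 𝒦)` (locally principal, `V(𝓔)` regular, (k-v), (k-vi)): `St 𝓔` is Cartier on `V(St 𝒦)` AND `St 𝒦` is Cartier on `V(St 𝓔)`.
  Pointwise (`isEffectiveCartier_of_forall_mem_nonZeroDivisors`): `(St 𝓔)_{y₂}` is prime (`V(St 𝓔) ≅ V(𝓔)` is regular, res-D-pv-051
  `exists_iso_subscheme_strictTransformIdeal_exceptional`) and misses the generator of `(St 𝒦)_{y₂} ∋ τ♯ f` (else `f ∈ 𝓔_x` by the kernel of
  `ι♯ ∘ τ♯`, against (k-vi)); then the domain swap `mul_mem_span_singleton_swap`; the second half is `isEffectiveCartier_comap_subschemeι_swap`.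

References (index only): [cite: GortzWedhorn2020, (13.19) and Prop. 13.91]; [cite: StacksProject, Tag 0BIQ and Tag 01WS]. Tree inputs as named.
-/

set_option linter.dupNamespace false -- mandated namespace `Summit.<Summit>.<Problem>` of this single-conjunct summit

noncomputable section

open CategoryTheory CategoryTheory.Limits AlgebraicGeometry TopologicalSpace Topology IsLocalRing
open Literature.AlgebraicGeometry.Resolution
open AlgebraicGeometry.Scheme.IdealSheafData

namespace Summit.ResolutionOfSingularities.ResolutionOfSingularities.Cruxes.EquisingularLiftNat.Sections

namespace CechShadow

section IsoOver

variable {X X₂ : Scheme.{0}} (τ : X₂ ⟶ X) (I₂ : X₂.IdealSheafData) (I : X.IdealSheafData)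
  (e : I₂.subscheme ≅ I.subscheme) (he : e.hom ≫ I.subschemeι = I₂.subschemeι ≫ τ)

include he in
/-- Point form of `exists_sub_stalkMap_mem_of_iso_over`: at `y₂ ∈ V(I₂)`, every germ of `X₂` is `τ♯ a` modulo `(I₂)_{y₂}`. [folklore] -/
theorem exists_sub_stalkMap_mem_of_iso_over' (y₂ : X₂) (hy₂ : y₂ ∈ (I₂.support : Set X₂)) (r : X₂.presheaf.stalk y₂) :
    ∃ a : X.presheaf.stalk (τ y₂), r - (τ.stalkMap y₂).hom a ∈ stalkIdeal I₂ y₂ := by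
  obtain ⟨z, rfl⟩ : y₂ ∈ Set.range I₂.subschemeι := by rw [Scheme.IdealSheafData.range_subschemeι]; exact hy₂
  exact exists_sub_stalkMap_mem_of_iso_over τ I₂ I e he z r

include he in
/-- Point form of `stalkMap_mem_sup_map_iff_of_iso_over`: at `y₂ ∈ V(I₂)`, `τ♯ b ∈ (I₂)_{y₂} + 𝔟·𝒪_{X₂,y₂} ↔ b ∈ I_{τ y₂} + 𝔟`. [folklore] -/
theorem stalkMap_mem_sup_map_iff_of_iso_over' (y₂ : X₂) (hy₂ : y₂ ∈ (I₂.support : Set X₂)) (𝔟 : Ideal (X.presheaf.stalk (τ y₂)))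
    (b : X.presheaf.stalk (τ y₂)) :
    (τ.stalkMap y₂).hom b ∈ stalkIdeal I₂ y₂ ⊔ 𝔟.map (τ.stalkMap y₂).hom ↔ b ∈ stalkIdeal I (τ y₂) ⊔ 𝔟 := by
  obtain ⟨z, rfl⟩ : y₂ ∈ Set.range I₂.subschemeι := by rw [Scheme.IdealSheafData.range_subschemeι]; exact hy₂
  exact stalkMap_mem_sup_map_iff_of_iso_over τ I₂ I e he z 𝔟 b

include he in
/-- Point form of `exists_ringEquiv_quotient_of_iso_over`: at `y₂ ∈ V(I₂)`, `𝒪_{X,τ y₂}/(I_{τ y₂} + 𝔟) ≃+* 𝒪_{X₂,y₂}/((I₂)_{y₂} + 𝔟·𝒪_{X₂,y₂})`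
through `τ♯`. [cite: GortzWedhorn2020, (13.19)] [OURS · L1 W4.5b] -/
theorem exists_ringEquiv_quotient_of_iso_over' (y₂ : X₂) (hy₂ : y₂ ∈ (I₂.support : Set X₂)) (𝔟 : Ideal (X.presheaf.stalk (τ y₂))) :
    ∃ Θ : X.presheaf.stalk (τ y₂) ⧸ (stalkIdeal I (τ y₂) ⊔ 𝔟) ≃+* X₂.presheaf.stalk y₂ ⧸ (stalkIdeal I₂ y₂ ⊔ 𝔟.map (τ.stalkMap y₂).hom),
      ∀ a, Θ (Ideal.Quotient.mk _ a) = Ideal.Quotient.mk _ ((τ.stalkMap y₂).hom a) := by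
  obtain ⟨z, rfl⟩ : y₂ ∈ Set.range I₂.subschemeι := by rw [Scheme.IdealSheafData.range_subschemeι]; exact hy₂
  exact exists_ringEquiv_quotient_of_iso_over τ I₂ I e he z 𝔟

end IsoOver

/-- **The old (k-iv) hypothesis from reducedness upstairs.** In a model square over a DVR (`j_G : G → X` the special fibre, `ϖ` a uniformiser),
if `𝒪_{X, j_G p}/((𝓔 + 𝒦)_{j_G p} + (ϖ))` is reduced and `𝓔·𝒪_G`, `𝒦·𝒪_G` have the stalks of `𝓘⟨E⟩`, `𝓘⟨K⟩` at `p`, then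
`(𝓘⟨E⟩ + 𝓘⟨K⟩)_p = 𝓘⟨E ∩ K⟩_p` (the sum is radical at `p`; `𝓘⟨E ∩ K⟩ = √(𝓘⟨E⟩ + 𝓘⟨K⟩)` by Mathlib `vanishingIdeal_support`). [folklore]
[cite: StacksProject, Tag 0BIQ] [OURS · L1 W4.5b] -/
theorem stalkIdeal_sup_vanishingIdeal_eq_inter_of_isReduced (O : Type) [CommRing O] [IsDomain O] [IsDiscreteValuationRing O]
    (k : Type) [Field k] (θ : O →+* k) (hθ : Function.Surjective θ) {X G : Scheme.{0}} (r : X ⟶ Spec (.of O))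
    (jG : G ⟶ X) (tG : G ⟶ Spec (.of k)) (hsq : IsPullback jG tG r (Spec.map (CommRingCat.ofHom θ)))
    (ϖ : O) (hϖ : Irreducible ϖ) (𝓔 𝒦 : X.IdealSheafData) (E K : Set G) (hE : IsClosed E) (hK : IsClosed K) (p : G)
    (hEp : stalkIdeal (𝓔.comap jG) p = stalkIdeal (vanishingIdeal (⟨E, hE⟩ : Closeds G)) p)
    (hKp : stalkIdeal (𝒦.comap jG) p = stalkIdeal (vanishingIdeal (⟨K, hK⟩ : Closeds G)) p)
    [IsReduced (X.presheaf.stalk (jG p) ⧸ (stalkIdeal (𝓔 ⊔ 𝒦) (jG p) ⊔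
      Ideal.span {(X.presheaf.Γgerm (jG p)).hom (r.appTop.hom ((Scheme.ΓSpecIso (.of O)).inv.hom ϖ))}))] :
    stalkIdeal (vanishingIdeal (⟨E, hE⟩ : Closeds G) ⊔ vanishingIdeal (⟨K, hK⟩ : Closeds G)) p =
      stalkIdeal (vanishingIdeal (⟨E ∩ K, hE.inter hK⟩ : Closeds G)) p := by
  classical
  haveI : IsClosedImmersion (Spec.map (CommRingCat.ofHom θ)) := IsClosedImmersion.spec_of_surjective _ hθ
  haveI : IsClosedImmersion jG := MorphismProperty.IsStableUnderBaseChange.of_isPullback hsq.flip inferInstance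
  set ψ := (jG.stalkMap p).hom with hψ
  obtain ⟨I₀, hI₀⟩ : ∃ I₀ : Ideal (X.presheaf.stalk (jG p)), I₀ = stalkIdeal (𝓔 ⊔ 𝒦) (jG p) := ⟨_, rfl⟩
  have hkerψ : RingHom.ker ψ = Ideal.span {(X.presheaf.Γgerm (jG p)).hom (r.appTop.hom ((Scheme.ΓSpecIso (.of O)).inv.hom ϖ))} := by
    refine le_antisymm (ker_stalkMap_model_le O k θ hθ r jG tG hsq p ϖ hϖ) ?_
    rw [Ideal.span_singleton_le_iff_mem, RingHom.mem_ker]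
    exact stalkMap_model_varpi θ hθ r jG tG hsq p ϖ (hϖ.maximalIdeal_eq ▸ Ideal.mem_span_singleton_self ϖ)
  -- `ψ(I₀) = (𝓘⟨E⟩ + 𝓘⟨K⟩)_p`
  have hmap : I₀.map ψ = stalkIdeal (vanishingIdeal (⟨E, hE⟩ : Closeds G) ⊔ vanishingIdeal (⟨K, hK⟩ : Closeds G)) p := by
    rw [hI₀, stalkIdeal_sup, Ideal.map_sup, hψ, ← stalkIdeal_comap_eq_map_stalkMap, ← stalkIdeal_comap_eq_map_stalkMap, hEp, hKp,
      ← stalkIdeal_sup]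
  -- `𝒪_{G,p}/ψ(I₀) ≅ 𝒪_{X,j p}/(I₀ + (ϖ))` is reduced
  set φ : (X.presheaf.stalk (jG p) : Type) →+* (G.presheaf.stalk p ⧸ I₀.map ψ) := (Ideal.Quotient.mk (I₀.map ψ)).comp ψ with hφ
  have hφsurj : Function.Surjective φ := Ideal.Quotient.mk_surjective.comp (jG.stalkMap_surjective p)
  have hkerφ : RingHom.ker φ = I₀ ⊔ Ideal.span {(X.presheaf.Γgerm (jG p)).hom (r.appTop.hom ((Scheme.ΓSpecIso (.of O)).inv.hom ϖ))} := by
    have h1 : RingHom.ker φ = Ideal.comap ψ (I₀.map ψ) := by rw [hφ, ← RingHom.comap_ker, Ideal.mk_ker]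
    rw [h1, Ideal.comap_map_of_surjective _ (jG.stalkMap_surjective p), ← RingHom.ker_eq_comap_bot, hkerψ]
  have e₁ := RingHom.quotientKerEquivOfSurjective hφsurj
  haveI : IsReduced (X.presheaf.stalk (jG p) ⧸ (I₀ ⊔ Ideal.span {(X.presheaf.Γgerm (jG p)).hom (r.appTop.hom ((Scheme.ΓSpecIso (.of O)).inv.hom ϖ))})) := by
    rw [hI₀]; infer_instance
  haveI : IsReduced (X.presheaf.stalk (jG p) ⧸ RingHom.ker φ) :=
    isReduced_of_injective (Ideal.quotEquivOfEq hkerφ).toRingHom (Ideal.quotEquivOfEq hkerφ).injective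
  haveI : IsReduced (G.presheaf.stalk p ⧸ I₀.map ψ) := isReduced_of_injective e₁.symm.toRingHom e₁.symm.injective
  have hrad : (stalkIdeal (vanishingIdeal (⟨E, hE⟩ : Closeds G) ⊔ vanishingIdeal (⟨K, hK⟩ : Closeds G)) p).IsRadical := by
    rw [← hmap]; exact (Ideal.isRadical_iff_quotient_reduced _).mpr inferInstance
  -- `𝓘⟨E ∩ K⟩ = √(𝓘⟨E⟩ + 𝓘⟨K⟩)`
  have hsupp : (⟨E ∩ K, hE.inter hK⟩ : Closeds G) = (vanishingIdeal (⟨E, hE⟩ : Closeds G) ⊔ vanishingIdeal (⟨K, hK⟩ : Closeds G)).support := by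
    apply Closeds.ext
    rw [Scheme.IdealSheafData.support_sup, Closeds.coe_inf, Scheme.IdealSheafData.coe_support_vanishingIdeal,
      Scheme.IdealSheafData.coe_support_vanishingIdeal]
    rfl
  rw [hsupp, Scheme.IdealSheafData.vanishingIdeal_support, stalkIdeal_radical, hrad.radical]


/-- **(k-v)′ and (k-vi)′ for the transported old pair.** See the module docstring. [cite: GortzWedhorn2020, (13.19)] [cite: StacksProject, Tag 01WS]
[OURS · L1 W4.5b] -/
theorem isEffectiveCartier_strictTransform_old_pair {X X₂ : Scheme.{0}} [IsIntegral X] [IsLocallyNoetherian X] (τ : X₂ ⟶ X)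
    (𝓔 𝒦 𝒦₁ : X.IdealSheafData) (hXreg : Scheme.IsRegular X) (he_ii : ∀ z : X, (stalkIdeal 𝓔 z).IsPrincipal)
    (he_iii : Scheme.IsRegular 𝓔.subscheme) (hk_i : ∀ z : X, (stalkIdeal 𝒦 z).IsPrincipal) (hk_v : IsEffectiveCartier (𝓔.comap 𝒦.subschemeι))
    (hk_vi : IsEffectiveCartier (𝒦.comap 𝓔.subschemeι)) (hc3 : Scheme.IsRegular (𝓔 ⊔ 𝒦₁).subscheme)
    (hc4 : IsEffectiveCartier (𝒦₁.comap 𝓔.subschemeι)) (hτ : IsBlowup τ (𝓔 ⊔ 𝒦₁)) :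
    IsEffectiveCartier ((strictTransformIdeal τ (𝓔 ⊔ 𝒦₁) 𝓔).comap (strictTransformIdeal τ (𝓔 ⊔ 𝒦₁) 𝒦).subschemeι) ∧
      IsEffectiveCartier ((strictTransformIdeal τ (𝓔 ⊔ 𝒦₁) 𝒦).comap (strictTransformIdeal τ (𝓔 ⊔ 𝒦₁) 𝓔).subschemeι) := by
  classical
  haveI : IsProper τ := hτ.isProper
  haveI hX₂noeth : IsLocallyNoetherian X₂ := LocallyOfFiniteType.isLocallyNoetherian τ
  -- the centre is non-zero; the blow-up is integral
  have hCne : 𝓔 ⊔ 𝒦₁ ≠ ⊥ := by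
    intro hbot
    have hE0 : 𝓔 = ⊥ := le_bot_iff.mp (hbot ▸ le_sup_left)
    have hK₁0 : 𝒦₁ = ⊥ := le_bot_iff.mp (hbot ▸ le_sup_right)
    obtain ⟨x₀⟩ := (inferInstance : Nonempty X)
    have hx₀ : x₀ ∈ (𝓔.support : Set X) := by rw [hE0, Scheme.IdealSheafData.support_bot]; trivial
    obtain ⟨xe, -⟩ : x₀ ∈ Set.range 𝓔.subschemeι := by rw [Scheme.IdealSheafData.range_subschemeι]; exact hx₀
    obtain ⟨t, ht, hKt⟩ := hc4.exists_stalkIdeal_eq_span xe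
    rw [hK₁0, Scheme.IdealSheafData.comap_bot, stalkIdeal_bot, eq_comm, Ideal.span_singleton_eq_bot] at hKt
    rw [hKt] at ht
    exact zero_notMem_nonZeroDivisors ht
  haveI hX₂int : IsIntegral X₂ := hτ.isIntegral hCne
  have hk1 : ∀ z : X₂, (stalkIdeal (strictTransformIdeal τ (𝓔 ⊔ 𝒦₁) 𝒦) z).IsPrincipal := fun z =>
    isPrincipal_stalkIdeal_strictTransformIdeal hXreg hc3 hτ hCne 𝒦 hk_i z
  have hs1 : ∀ z : X₂, (stalkIdeal (strictTransformIdeal τ (𝓔 ⊔ 𝒦₁) 𝓔) z).IsPrincipal := fun z =>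
    isPrincipal_stalkIdeal_strictTransformIdeal hXreg hc3 hτ hCne 𝓔 he_ii z
  -- the old exceptional surface does not move: `V(St 𝓔) ≅ V(𝓔)` over `τ`
  obtain ⟨e𝓔, he𝓔⟩ := exists_iso_subscheme_strictTransformIdeal_exceptional 𝓔 𝒦₁ hc4 hτ
  have hs3 : Scheme.IsRegular (strictTransformIdeal τ (𝓔 ⊔ 𝒦₁) 𝓔).subscheme := Scheme.IsRegular.of_isOpenImmersion e𝓔.hom he_iii
  have hsuppStE : ∀ y₂ : X₂, y₂ ∈ ((strictTransformIdeal τ (𝓔 ⊔ 𝒦₁) 𝓔).support : Set X₂) → τ y₂ ∈ (𝓔.support : Set X) := by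
    intro y₂ h
    have h' := Scheme.IdealSheafData.support_antitone (comap_le_strictTransformIdeal τ (𝓔 ⊔ 𝒦₁) 𝓔) h
    rw [Scheme.IdealSheafData.support_comap] at h'
    exact h'
  have hsuppStK : ∀ y₂ : X₂, y₂ ∈ ((strictTransformIdeal τ (𝓔 ⊔ 𝒦₁) 𝒦).support : Set X₂) → τ y₂ ∈ (𝒦.support : Set X) := by
    intro y₂ h
    have h' := Scheme.IdealSheafData.support_antitone (comap_le_strictTransformIdeal τ (𝓔 ⊔ 𝒦₁) 𝒦) h
    rw [Scheme.IdealSheafData.support_comap] at h'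
    exact h'
  -- `𝓔 ≠ ⊥` as soon as `V(𝒦)` has a point (by (k-v)), and then `St 𝓔 ≠ ⊥`
  have hStEne : ∀ x : X, x ∈ (𝒦.support : Set X) → strictTransformIdeal τ (𝓔 ⊔ 𝒦₁) 𝓔 ≠ ⊥ := by
    intro x hx h0
    have h𝓔ne : 𝓔 ≠ ⊥ := by
      intro hE0
      obtain ⟨xk, -⟩ : x ∈ Set.range 𝒦.subschemeι := by rw [Scheme.IdealSheafData.range_subschemeι]; exact hx
      obtain ⟨t, ht, hEt⟩ := hk_v.exists_stalkIdeal_eq_span xk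
      rw [hE0, Scheme.IdealSheafData.comap_bot, stalkIdeal_bot, eq_comm, Ideal.span_singleton_eq_bot] at hEt
      rw [hEt] at ht
      exact zero_notMem_nonZeroDivisors ht
    have hle : 𝓔.comap τ ≤ strictTransformIdeal τ (𝓔 ⊔ 𝒦₁) 𝓔 := comap_le_strictTransformIdeal τ (𝓔 ⊔ 𝒦₁) 𝓔
    rw [h0, le_bot_iff] at hle
    obtain ⟨z₀⟩ := (inferInstance : Nonempty X₂)
    apply stalkIdeal_ne_bot_of_ne_bot h𝓔ne (τ z₀)
    have h3 : stalkIdeal (𝓔.comap τ) z₀ = ⊥ := by rw [hle, stalkIdeal_bot]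
    rw [stalkIdeal_comap_eq_map_stalkMap] at h3
    exact (Ideal.map_eq_bot_iff_of_injective (hτ.stalkMap_injective z₀)).mp h3
  -- (k-v)′: the old surface is Cartier on the transported shadow
  have C4 : IsEffectiveCartier ((strictTransformIdeal τ (𝓔 ⊔ 𝒦₁) 𝓔).comap (strictTransformIdeal τ (𝓔 ⊔ 𝒦₁) 𝒦).subschemeι) := by
    haveI : IsLocallyNoetherian (strictTransformIdeal τ (𝓔 ⊔ 𝒦₁) 𝒦).subscheme :=
      LocallyOfFiniteType.isLocallyNoetherian (strictTransformIdeal τ (𝓔 ⊔ 𝒦₁) 𝒦).subschemeι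
    refine isEffectiveCartier_of_forall_mem_nonZeroDivisors fun s hs => ?_
    have hyK : (strictTransformIdeal τ (𝓔 ⊔ 𝒦₁) 𝒦).subschemeι s ∈ ((strictTransformIdeal τ (𝓔 ⊔ 𝒦₁) 𝒦).support : Set X₂) := by
      rw [← Scheme.IdealSheafData.range_subschemeι]; exact ⟨s, rfl⟩
    have hyE : (strictTransformIdeal τ (𝓔 ⊔ 𝒦₁) 𝒦).subschemeι s ∈ ((strictTransformIdeal τ (𝓔 ⊔ 𝒦₁) 𝓔).support : Set X₂) := by
      have h1 : s ∈ ((((strictTransformIdeal τ (𝓔 ⊔ 𝒦₁) 𝓔).comap (strictTransformIdeal τ (𝓔 ⊔ 𝒦₁) 𝒦).subschemeι)).support : Set _) := hs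
      rw [Scheme.IdealSheafData.support_comap] at h1
      exact h1
    have hxE := hsuppStE _ hyE
    have hxK := hsuppStK _ hyK
    -- generators
    obtain ⟨g, hg⟩ := (hs1 ((strictTransformIdeal τ (𝓔 ⊔ 𝒦₁) 𝒦).subschemeι s)).principal
    have hg' : stalkIdeal (strictTransformIdeal τ (𝓔 ⊔ 𝒦₁) 𝓔) ((strictTransformIdeal τ (𝓔 ⊔ 𝒦₁) 𝒦).subschemeι s) = Ideal.span {g} := by
      rw [hg, Ideal.submodule_span_eq]
    obtain ⟨f₂, hf₂⟩ := (hk1 ((strictTransformIdeal τ (𝓔 ⊔ 𝒦₁) 𝒦).subschemeι s)).principal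
    have hf₂' : stalkIdeal (strictTransformIdeal τ (𝓔 ⊔ 𝒦₁) 𝒦) ((strictTransformIdeal τ (𝓔 ⊔ 𝒦₁) 𝒦).subschemeι s) = Ideal.span {f₂} := by
      rw [hf₂, Ideal.submodule_span_eq]
    obtain ⟨e, he⟩ := (he_ii (τ ((strictTransformIdeal τ (𝓔 ⊔ 𝒦₁) 𝒦).subschemeι s))).principal
    have he' : stalkIdeal 𝓔 (τ ((strictTransformIdeal τ (𝓔 ⊔ 𝒦₁) 𝒦).subschemeι s)) = Ideal.span {e} := by rw [he, Ideal.submodule_span_eq]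
    obtain ⟨f, hf⟩ := (hk_i (τ ((strictTransformIdeal τ (𝓔 ⊔ 𝒦₁) 𝒦).subschemeι s))).principal
    have hf' : stalkIdeal 𝒦 (τ ((strictTransformIdeal τ (𝓔 ⊔ 𝒦₁) 𝒦).subschemeι s)) = Ideal.span {f} := by rw [hf, Ideal.submodule_span_eq]
    refine ⟨((strictTransformIdeal τ (𝓔 ⊔ 𝒦₁) 𝒦).subschemeι.stalkMap s).hom g, ?_, by
      rw [stalkIdeal_comap_eq_map_stalkMap, hg', Ideal.map_span, Set.image_singleton]⟩
    -- `(St 𝓔)_{y₂} = (g)` is prime and does not contain `f₂`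
    have hP : (Ideal.span {g} : Ideal (X₂.presheaf.stalk ((strictTransformIdeal τ (𝓔 ⊔ 𝒦₁) 𝒦).subschemeι s))).IsPrime := by
      rw [← hg']; exact isPrime_stalkIdeal_of_isRegular_subscheme hs3 hyE
    have hfe : f ∉ stalkIdeal 𝓔 (τ ((strictTransformIdeal τ (𝓔 ⊔ 𝒦₁) 𝒦).subschemeι s)) := by
      intro hfE
      have hreg := regular_mod_of_isEffectiveCartier_comap 𝒦 𝓔 hk_vi _ hxE f e hf' he'
      have h1 : (1 : X.presheaf.stalk (τ ((strictTransformIdeal τ (𝓔 ⊔ 𝒦₁) 𝒦).subschemeι s))) ∈ Ideal.span {e} :=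
        hreg 1 (by rw [mul_one, ← he']; exact hfE)
      have h2 := (mem_support_iff_stalkIdeal_le 𝓔 _).mp hxE
      rw [he'] at h2
      exact (maximalIdeal.isMaximal _).ne_top (Ideal.eq_top_of_isUnit_mem _ (h2 h1) isUnit_one)
    have hf₂P : f₂ ∉ Ideal.span {g} := by
      intro hmem
      -- `τ♯ f ∈ (St 𝒦)_{y₂} = (f₂) ⊆ (g) = (St 𝓔)_{y₂}`, hence `f ∈ 𝓔_x`
      have h1 : (τ.stalkMap ((strictTransformIdeal τ (𝓔 ⊔ 𝒦₁) 𝒦).subschemeι s)).hom f ∈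
          stalkIdeal (strictTransformIdeal τ (𝓔 ⊔ 𝒦₁) 𝒦) ((strictTransformIdeal τ (𝓔 ⊔ 𝒦₁) 𝒦).subschemeι s) := by
        refine stalkIdeal_mono (comap_le_strictTransformIdeal τ (𝓔 ⊔ 𝒦₁) 𝒦) _ ?_
        rw [stalkIdeal_comap_eq_map_stalkMap, hf']
        exact Ideal.mem_map_of_mem _ (Ideal.mem_span_singleton_self f)
      rw [hf₂'] at h1
      have h2 : (τ.stalkMap ((strictTransformIdeal τ (𝓔 ⊔ 𝒦₁) 𝒦).subschemeι s)).hom f ∈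
          stalkIdeal (strictTransformIdeal τ (𝓔 ⊔ 𝒦₁) 𝓔) ((strictTransformIdeal τ (𝓔 ⊔ 𝒦₁) 𝒦).subschemeι s) := by
        rw [hg']; exact (Ideal.span_singleton_le_iff_mem _).mpr hmem h1
      have h3 := (stalkMap_mem_sup_map_iff_of_iso_over' τ _ 𝓔 e𝓔 he𝓔 _ hyE ⊥ f).mp (by rw [Ideal.map_bot, sup_bot_eq]; exact h2)
      rw [sup_bot_eq] at h3
      exact hfe h3
    have hreg₂ : ∀ a, f₂ * a ∈ Ideal.span {g} → a ∈ Ideal.span {g} := fun a ha => (hP.mem_or_mem ha).resolve_left hf₂P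
    -- `g ≠ 0` in the domain `𝒪_{X₂,y₂}`
    have hg0 : ∀ b, g * b = 0 → b = 0 := by
      intro b hb
      refine (mul_eq_zero.mp hb).resolve_left fun h0 => ?_
      apply stalkIdeal_ne_bot_of_ne_bot (hStEne _ hxK) ((strictTransformIdeal τ (𝓔 ⊔ 𝒦₁) 𝒦).subschemeι s)
      rw [hg', h0, Ideal.span_singleton_eq_bot]
    have hker : RingHom.ker ((strictTransformIdeal τ (𝓔 ⊔ 𝒦₁) 𝒦).subschemeι.stalkMap s).hom = Ideal.span {f₂} := by
      rw [← stalkIdeal_ker_eq_ker_stalkMap, Scheme.IdealSheafData.ker_subschemeι, hf₂']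
    rw [mem_nonZeroDivisors_iff_right]
    intro r hr
    obtain ⟨r, rfl⟩ := ((strictTransformIdeal τ (𝓔 ⊔ 𝒦₁) 𝒦).subschemeι).stalkMap_surjective s r
    rw [← map_mul, ← RingHom.mem_ker, hker, mul_comm] at hr
    rw [← RingHom.mem_ker, hker]
    exact mul_mem_span_singleton_swap hg0 hreg₂ r hr
  have C5 : IsEffectiveCartier ((strictTransformIdeal τ (𝓔 ⊔ 𝒦₁) 𝒦).comap (strictTransformIdeal τ (𝓔 ⊔ 𝒦₁) 𝓔).subschemeι) := by
    -- (k-vi)′ by the swap (the transported old surface is regular, both ideals are locally principal)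
    by_cases hK0 : 𝒦 = ⊥
    · -- degenerate: `𝒦 = ⊥` forces `V(𝓔) = ∅` (by (k-vi)), hence `St 𝓔 = ⊤`
      have hEtop : 𝓔 = ⊤ := by
        rw [← Scheme.IdealSheafData.support_eq_bot_iff, eq_bot_iff]
        intro x hx
        obtain ⟨xe, -⟩ : x ∈ Set.range 𝓔.subschemeι := by rw [Scheme.IdealSheafData.range_subschemeι]; exact hx
        obtain ⟨t, ht, hKt⟩ := hk_vi.exists_stalkIdeal_eq_span xe
        rw [hK0, Scheme.IdealSheafData.comap_bot, stalkIdeal_bot, eq_comm, Ideal.span_singleton_eq_bot] at hKt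
        rw [hKt] at ht
        exact absurd ht (zero_notMem_nonZeroDivisors)
      have hcomaptop : 𝓔.comap τ = ⊤ := by rw [hEtop, Scheme.IdealSheafData.comap_top]
      have hStEtop : strictTransformIdeal τ (𝓔 ⊔ 𝒦₁) 𝓔 = ⊤ := by
        refine top_le_iff.mp ?_
        have h := comap_le_strictTransformIdeal τ (𝓔 ⊔ 𝒦₁) 𝓔
        rw [hcomaptop] at h
        exact h
      rw [hStEtop]
      intro z
      exfalso
      have hz : ((⊤ : X₂.IdealSheafData)).subschemeι z ∈ ((⊤ : X₂.IdealSheafData).support : Set X₂) := by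
        rw [← Scheme.IdealSheafData.range_subschemeι]; exact ⟨z, rfl⟩
      rw [Scheme.IdealSheafData.support_top] at hz
      exact hz
    · have hStne : strictTransformIdeal τ (𝓔 ⊔ 𝒦₁) 𝒦 ≠ ⊥ := by
        intro h0
        obtain ⟨z₀⟩ := (inferInstance : Nonempty X₂)
        have hle : 𝒦.comap τ ≤ strictTransformIdeal τ (𝓔 ⊔ 𝒦₁) 𝒦 := comap_le_strictTransformIdeal τ (𝓔 ⊔ 𝒦₁) 𝒦
        rw [h0, le_bot_iff] at hle
        apply stalkIdeal_ne_bot_of_ne_bot hK0 (τ z₀)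
        have h3 : stalkIdeal (𝒦.comap τ) z₀ = ⊥ := by rw [hle, stalkIdeal_bot]
        rw [stalkIdeal_comap_eq_map_stalkMap] at h3
        exact (Ideal.map_eq_bot_iff_of_injective (hτ.stalkMap_injective z₀)).mp h3
      exact isEffectiveCartier_comap_subschemeι_swap (strictTransformIdeal τ (𝓔 ⊔ 𝒦₁) 𝓔) (strictTransformIdeal τ (𝓔 ⊔ 𝒦₁) 𝒦) hs1 hk1 hs3
        hStne C4

  exact ⟨C4, C5⟩

end CechShadow

end Summit.ResolutionOfSingularities.ResolutionOfSingularities.Cruxes.EquisingularLiftNat.Sections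

end
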